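import Summits.QuantumFields.GaugeBoot.PolynomialFunctionalsRealisable
import Summits.QuantumFields.GaugeBoot.PolynomialSchwingerDyson
import HarnessLib

/-!
# Bootstrap functionals: loop equations + positivity + normalisation determine the Wilson expectations, with NO realisability hypothesis (gauge-boot, L1 supplement)

HONEST FRAMING (cell `pub-gaugeboot`, page 1 of every file): the venture produces certified bounds
on lattice expectations at stated coupling, gauge group, dimension and torus size; NOT a mass gap,
NOT a continuum limit, NOT a string tension; NOT Yang–Mills-summit-bearing (barriers
`FixedCouplingUltralocality`, `PerturbativeInvisibility`). Structural; it certifies no number.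

## Content

The UNTRUNCATED lattice bootstrap, stated exactly as the data an SDP manipulates: a LINEAR
assignment `φ` of values to the polynomial observables (`polyAlgebra r`) such that
(N) `φ 1 = 1`, (P) `0 ≤ φ (a a)` for every polynomial `a` (all moment matrices PSD), and
(SD) the Schwinger–Dyson / loop equations hold as LINEAR IDENTITIES `φ f' = β φ (f S_i')` among
polynomial values (`IsSDFunctional`; `f'`, `S_i'` the polynomial derivatives along the one-link
shifts `U ↦ U[i ↦ e^{tX} U_i]` — `exists_deriv_mem_polyAlgebra`: the polynomial observables are
closed under these derivatives).

* `isSDFunctional_expectationFunctional_iff` — for a probability measure, (SD) for its expectation functional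
  ⇔ it is a polynomial Schwinger–Dyson state (`PolynomialSchwingerDysonSeries`);
* ★★★ `exists_polySD_measure_of_bootstrap` — (N)+(P)+(SD) ⇒ `φ` is, on all polynomials, the
  expectation of a (unique) polynomial Schwinger–Dyson probability state (realisability from
  `PolynomialFunctionalsRealisable.lean`, then transfer of the rows);
* ★★★ `eq_wilson_of_bootstrap_suN` / `_uN` — `SU(N)` / `U(N)` on the torus `(ℤ/L)^d`, ANY real
  `β`: every solution of (N)+(P)+(SD) IS the Wilson expectation on every polynomial observable —
  the untruncated bootstrap has exactly one solution; ★★★ `exists_dlr_of_bootstrap_suN` / `_uN` —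
  on `ℤ^d`: every solution is the expectation functional of a DLR state (and conversely,
  `bootstrap_of_dlr_suN`).

What this is NOT: a statement about TRUNCATED bootstraps (finitely many words / PSD blocks) —
their convergence is the sequel `BootstrapConvergence.lean`; nor about rates.

References: P. Anderson, M. Kruczenski, Nucl. Phys. B 921 (2017); V. Kazakov, Z. Zheng,
arXiv:2203.11360; Z. Li, S. Zhou, arXiv:2404.17071. Folklore.
-/

noncomputable section

open MeasureTheory Filter Topology NormedSpace
open Literature.MathematicalPhysics.QuantumFieldTheory (haarProbability LatticeRep)

namespace Summit.QuantumFields.GaugeBoot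

/-! ## Polynomial observables are closed under the one-link shift derivatives -/

section Deriv

variable {ι : Type*} [DecidableEq ι] {G : Type*} [Group G] [TopologicalSpace G] (r : LatticeRep G)

/-- The derivative of the generator `Re ρ(U_e)_{ab}` along `U ↦ U[e ↦ e^{tX} U_e]`, as a polynomial
observable: `Σ_c (Re X_{ac} · Re ρ(U_e)_{cb} - Im X_{ac} · Im ρ(U_e)_{cb}) = Re (X ρ(U_e))_{ab}`.
[folklore] -/
def reEntryShiftDeriv (X : Matrix (Fin r.N) (Fin r.N) ℂ) (e : ι) (a b : Fin r.N) : C(ι → G, ℝ) :=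
  ∑ c, ((X a c).re • reEntry r e c b - (X a c).im • imEntry r e c b)

/-- The derivative of the generator `Im ρ(U_e)_{ab}`: `Im (X ρ(U_e))_{ab}`. [folklore] -/
def imEntryShiftDeriv (X : Matrix (Fin r.N) (Fin r.N) ℂ) (e : ι) (a b : Fin r.N) : C(ι → G, ℝ) :=
  ∑ c, ((X a c).re • imEntry r e c b + (X a c).im • reEntry r e c b)

omit [DecidableEq ι] in
/-- `reEntryShiftDeriv` evaluated. -/
theorem reEntryShiftDeriv_apply (X : Matrix (Fin r.N) (Fin r.N) ℂ) (e : ι) (a b : Fin r.N)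
    (U : ι → G) : reEntryShiftDeriv r X e a b U = ((X * r.ρ (U e)) a b).re := by
  simp [reEntryShiftDeriv, Matrix.mul_apply, Complex.re_sum, Complex.mul_re, ContinuousMap.coe_sum,
    Finset.sum_apply]

omit [DecidableEq ι] in
/-- `imEntryShiftDeriv` evaluated. -/
theorem imEntryShiftDeriv_apply (X : Matrix (Fin r.N) (Fin r.N) ℂ) (e : ι) (a b : Fin r.N)
    (U : ι → G) : imEntryShiftDeriv r X e a b U = ((X * r.ρ (U e)) a b).im := by
  simp [imEntryShiftDeriv, Matrix.mul_apply, Complex.im_sum, Complex.mul_im, ContinuousMap.coe_sum,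
    Finset.sum_apply]

omit [DecidableEq ι] in
/-- `reEntryShiftDeriv` is a polynomial observable. -/
theorem reEntryShiftDeriv_mem (X : Matrix (Fin r.N) (Fin r.N) ℂ) (e : ι) (a b : Fin r.N) :
    reEntryShiftDeriv r X e a b ∈ polyAlgebra (ι := ι) r :=
  Subalgebra.sum_mem _ fun c _ => Subalgebra.sub_mem _
    (Subalgebra.smul_mem _ (reEntry_mem r e c b) _) (Subalgebra.smul_mem _ (imEntry_mem r e c b) _)

omit [DecidableEq ι] in
/-- `imEntryShiftDeriv` is a polynomial observable. -/
theorem imEntryShiftDeriv_mem (X : Matrix (Fin r.N) (Fin r.N) ℂ) (e : ι) (a b : Fin r.N) :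
    imEntryShiftDeriv r X e a b ∈ polyAlgebra (ι := ι) r :=
  Subalgebra.sum_mem _ fun c _ => Subalgebra.add_mem _
    (Subalgebra.smul_mem _ (imEntry_mem r e c b) _) (Subalgebra.smul_mem _ (reEntry_mem r e c b) _)

/-- ★ **The polynomial observables are closed under the one-link shift derivatives**: every
`f ∈ polyAlgebra r` has, along `U ↦ U[e ↦ k(t) U_e]` with `ρ(k t) = e^{tX}`, a derivative which is
again a polynomial observable (induction over the algebra: generators by `hasDerivAt_rho_update`,
Leibniz). [folklore] -/
theorem exists_deriv_mem_polyAlgebra [ContinuousMul G] {k : ℝ → G} (hk : ∀ s t, k (s + t) = k s * k t)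
    {X : Matrix (Fin r.N) (Fin r.N) ℂ} (hX : ∀ t, r.ρ (k t) = exp ((t : ℂ) • X)) (e : ι)
    {f : C(ι → G, ℝ)} (hf : f ∈ polyAlgebra (ι := ι) r) :
    ∃ f' ∈ polyAlgebra (ι := ι) r,
      ∀ U, HasDerivAt (fun t => f (Function.update U e (k t * U e))) (f' U) 0 := by
  have h0 : k 0 = 1 := by
    have h := hk 0 0
    rw [add_zero] at h
    exact mul_eq_left.1 h.symm
  have hU0 : ∀ U : ι → G, Function.update U e (k 0 * U e) = U := fun U => by
    rw [h0, one_mul, Function.update_eq_self]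
  induction hf using Algebra.adjoin_induction with
  | mem g hg =>
    rcases hg with ⟨⟨e', a, b⟩, rfl⟩ | ⟨⟨e', a, b⟩, rfl⟩
    · by_cases he : e' = e
      · subst he
        refine ⟨reEntryShiftDeriv r X e' a b, reEntryShiftDeriv_mem r X e' a b, fun U => ?_⟩
        have h := hasDerivAt_entry_re (hasDerivAt_rho_update r.ρ hX e' e' U) a b
        rw [if_pos rfl] at h
        rw [reEntryShiftDeriv_apply]
        simpa only [reEntry_apply] using h
      · refine ⟨0, Subalgebra.zero_mem _, fun U => ?_⟩
        have h := hasDerivAt_entry_re (hasDerivAt_rho_update r.ρ hX e e' U) a b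
        rw [if_neg he] at h
        simpa only [reEntry_apply, Matrix.zero_apply, Complex.zero_re, ContinuousMap.zero_apply] using h
    · by_cases he : e' = e
      · subst he
        refine ⟨imEntryShiftDeriv r X e' a b, imEntryShiftDeriv_mem r X e' a b, fun U => ?_⟩
        have h := hasDerivAt_entry_im (hasDerivAt_rho_update r.ρ hX e' e' U) a b
        rw [if_pos rfl] at h
        rw [imEntryShiftDeriv_apply]
        simpa only [imEntry_apply] using h
      · refine ⟨0, Subalgebra.zero_mem _, fun U => ?_⟩
        have h := hasDerivAt_entry_im (hasDerivAt_rho_update r.ρ hX e e' U) a b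
        rw [if_neg he] at h
        simpa only [imEntry_apply, Matrix.zero_apply, Complex.zero_im, ContinuousMap.zero_apply] using h
  | algebraMap c =>
    refine ⟨0, Subalgebra.zero_mem _, fun U => ?_⟩
    simp only [Algebra.algebraMap_eq_smul_one, ContinuousMap.smul_apply, ContinuousMap.one_apply,
      ContinuousMap.zero_apply]
    exact hasDerivAt_const _ _
  | add f g _ _ ihf ihg =>
    obtain ⟨f', hf'm, hf'⟩ := ihf
    obtain ⟨g', hg'm, hg'⟩ := ihg
    refine ⟨f' + g', Subalgebra.add_mem _ hf'm hg'm, fun U => ?_⟩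
    have h : HasDerivAt (fun t => f (Function.update U e (k t * U e)) +
        g (Function.update U e (k t * U e))) (f' U + g' U) 0 := (hf' U).add (hg' U)
    simpa only [ContinuousMap.add_apply] using h
  | mul f g hfA hgA ihf ihg =>
    obtain ⟨f', hf'm, hf'⟩ := ihf
    obtain ⟨g', hg'm, hg'⟩ := ihg
    refine ⟨f' * g + f * g', Subalgebra.add_mem _ (Subalgebra.mul_mem _ hf'm hgA)
      (Subalgebra.mul_mem _ hfA hg'm), fun U => ?_⟩
    have h : HasDerivAt (fun t => f (Function.update U e (k t * U e)) *
        g (Function.update U e (k t * U e)))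
        (f' U * g (Function.update U e (k 0 * U e)) + f (Function.update U e (k 0 * U e)) * g' U) 0 :=
      (hf' U).mul (hg' U)
    simp only [hU0] at h
    simpa only [ContinuousMap.mul_apply, ContinuousMap.add_apply] using h

end Deriv

/-! ## Schwinger–Dyson functionals -/

section SD

variable {ι : Type*} [DecidableEq ι] [Countable ι] {G : Type*} [Group G] [TopologicalSpace G]
  [IsTopologicalGroup G] [CompactSpace G] [MeasurableSpace G] [BorelSpace G]
  [SecondCountableTopology G] (r : LatticeRep G) {K : Type*}

/-- **Schwinger–Dyson functional** (the loop equations as LINEAR IDENTITIES among the values a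
bootstrap assigns to polynomial observables): for every link `i` and generator `a`, the local action
`S i` has a polynomial derivative `S'` along `U ↦ U[i ↦ k a (t) U_i]`, and `φ f' = β φ (f S')` for
every polynomial `f` with polynomial derivative `f'` along the same shift. No measure, no
positivity, no continuity is presupposed. [shape] A parametric definition of a proposition — NOT a
fact. [folklore] -/
def IsSDFunctional (k : K → ℝ → G) (S : ι → (ι → G) → ℝ) (β : ℝ) (φ : C(ι → G, ℝ) →ₗ[ℝ] ℝ) :
    Prop :=
  ∀ (i : ι) (a : K), ∃ S' ∈ polyAlgebra (ι := ι) r,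
    (∀ U, HasDerivAt (fun t => S i (Function.update U i (k a t * U i))) (S' U) 0) ∧
      ∀ f ∈ polyAlgebra (ι := ι) r, ∀ f' ∈ polyAlgebra (ι := ι) r,
        (∀ U, HasDerivAt (fun t => f (Function.update U i (k a t * U i))) (f' U) 0) →
          φ f' = β * φ (f * S')

/-- **The expectation functional** `f ↦ ∫ f dμ` of a finite measure on the configurations, as a
linear functional on `C(ι → G, ℝ)`. [folklore] -/
def expectationFunctional (μ : Measure (ι → G)) [IsFiniteMeasure μ] : C(ι → G, ℝ) →ₗ[ℝ] ℝ where
  toFun f := ∫ U, f U ∂μ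
  map_add' f g := by
    simpa only [ContinuousMap.add_apply] using integral_add
      (integrable_of_continuous_compact f.continuous μ) (integrable_of_continuous_compact g.continuous μ)
  map_smul' c f := by
    simpa only [ContinuousMap.smul_apply, smul_eq_mul, RingHom.id_apply] using
      integral_const_mul c (fun U => f U)

omit [DecidableEq ι] [Group G] [IsTopologicalGroup G] in
/-- `expectationFunctional` evaluated. -/
@[simp] theorem expectationFunctional_apply (μ : Measure (ι → G)) [IsFiniteMeasure μ] (f : C(ι → G, ℝ)) :
    expectationFunctional μ f = ∫ U, f U ∂μ := rfl

omit [DecidableEq ι] [Group G] [IsTopologicalGroup G] in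
/-- The expectation functional of a probability measure is normalised. -/
theorem expectationFunctional_one (μ : Measure (ι → G)) [IsProbabilityMeasure μ] : expectationFunctional μ 1 = 1 := by
  simp

omit [DecidableEq ι] [Group G] [IsTopologicalGroup G] in
/-- The expectation functional of a measure is square-positive. -/
theorem expectationFunctional_sq_nonneg (μ : Measure (ι → G)) [IsFiniteMeasure μ] (a : C(ι → G, ℝ)) :
    0 ≤ expectationFunctional μ (a * a) :=
  integral_nonneg fun U => by simpa using mul_self_nonneg (a U)

variable {k : K → ℝ → G} {X : K → Matrix (Fin r.N) (Fin r.N) ℂ} {S : ι → (ι → G) → ℝ} {β : ℝ}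

omit [Countable ι] [CompactSpace G] [BorelSpace G] [SecondCountableTopology G] in
/-- **Transfer, functional ⇒ measure.** If `φ` is a Schwinger–Dyson functional and the finite
measure `μ` realises `φ` on the polynomial observables, then `μ` is a polynomial Schwinger–Dyson
state (a continuous derivative of a polynomial along the shift is THE polynomial derivative, by
uniqueness of derivatives). [folklore] -/
theorem isPolySchwingerDysonState_of_isSDFunctional (hk : ∀ a s t, k a (s + t) = k a s * k a t)
    (hX : ∀ a t, r.ρ (k a t) = exp ((t : ℂ) • X a)) {φ : C(ι → G, ℝ) →ₗ[ℝ] ℝ}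
    (hφ : IsSDFunctional r k S β φ) (μ : Measure (ι → G)) [IsFiniteMeasure μ]
    (hμ : ∀ a ∈ polyAlgebra (ι := ι) r, ∫ U, a U ∂μ = φ a) : IsPolySchwingerDysonState r k S β μ := by
  intro i a
  obtain ⟨S', hS'm, hS', hrows⟩ := hφ i a
  refine ⟨S', S'.continuous, hS', fun f hf f' hf'c hf' => ?_⟩
  obtain ⟨f₀, hf₀, rfl⟩ := (mem_polyFunctions_iff r).1 hf
  obtain ⟨f₀', hf₀'m, hf₀'⟩ := exists_deriv_mem_polyAlgebra r (hk a) (hX a) i hf₀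
  have he : f' = ⇑f₀' := funext fun U => (hf' U).unique (hf₀' U)
  rw [he, hμ _ hf₀'m, hrows f₀ hf₀ f₀' hf₀'m hf₀', ← hμ _ ((polyAlgebra (ι := ι) r).mul_mem hf₀ hS'm)]
  rfl

/-- **Transfer, measure ⇒ functional.** The expectation functional of a polynomial
Schwinger–Dyson finite measure is a Schwinger–Dyson functional, provided the local actions are
polynomial. [folklore] -/
theorem isSDFunctional_expectationFunctional (hk : ∀ a s t, k a (s + t) = k a s * k a t)
    (hX : ∀ a t, r.ρ (k a t) = exp ((t : ℂ) • X a)) (hS : ∀ i, S i ∈ polyFunctions (ι := ι) r)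
    (μ : Measure (ι → G)) [IsFiniteMeasure μ] (hμ : IsPolySchwingerDysonState r k S β μ) :
    IsSDFunctional r k S β (expectationFunctional μ) := by
  intro i a
  obtain ⟨S₀, hS₀, hS₀e⟩ := (mem_polyFunctions_iff r).1 (hS i)
  obtain ⟨S', hS'm, hS'⟩ := exists_deriv_mem_polyAlgebra r (hk a) (hX a) i hS₀
  obtain ⟨S'', hS''c, hS'', hrows⟩ := hμ i a
  have hS'i : ∀ U, HasDerivAt (fun t => S i (Function.update U i (k a t * U i))) (S' U) 0 := by
    rw [← hS₀e]; exact hS'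
  have he : S'' = ⇑S' := funext fun U => (hS'' U).unique (hS'i U)
  refine ⟨S', hS'm, hS'i, fun f hf f' hf'm hf' => ?_⟩
  rw [expectationFunctional_apply, expectationFunctional_apply, hrows (⇑f) (coe_mem_polyFunctions r hf) (⇑f')
    f'.continuous hf', he]
  rfl

/-- ★ **For a probability (finite) measure: Schwinger–Dyson functional ⇔ polynomial Schwinger–Dyson
state.** [folklore] -/
theorem isSDFunctional_expectationFunctional_iff (hk : ∀ a s t, k a (s + t) = k a s * k a t)
    (hX : ∀ a t, r.ρ (k a t) = exp ((t : ℂ) • X a)) (hS : ∀ i, S i ∈ polyFunctions (ι := ι) r)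
    (μ : Measure (ι → G)) [IsFiniteMeasure μ] :
    IsSDFunctional r k S β (expectationFunctional μ) ↔ IsPolySchwingerDysonState r k S β μ :=
  ⟨fun h => isPolySchwingerDysonState_of_isSDFunctional r hk hX h μ fun _ _ => rfl,
    isSDFunctional_expectationFunctional r hk hX hS μ⟩

/-- ★★★ **The untruncated bootstrap is realised by a unique polynomial Schwinger–Dyson state.**
A linear functional which is normalised, square-positive on the polynomial observables and a
Schwinger–Dyson functional coincides on every polynomial observable with the expectation of a
probability measure which is a polynomial Schwinger–Dyson state; the measure is unique.
[folklore] -/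
theorem exists_polySD_measure_of_bootstrap (hk : ∀ a s t, k a (s + t) = k a s * k a t)
    (hX : ∀ a t, r.ρ (k a t) = exp ((t : ℂ) • X a)) {φ : C(ι → G, ℝ) →ₗ[ℝ] ℝ} (h1 : φ 1 = 1)
    (hpos : ∀ a ∈ polyAlgebra (ι := ι) r, 0 ≤ φ (a * a)) (hφ : IsSDFunctional r k S β φ) :
    ∃ μ : Measure (ι → G), IsProbabilityMeasure μ ∧ IsPolySchwingerDysonState r k S β μ ∧
      (∀ a ∈ polyAlgebra (ι := ι) r, φ a = ∫ U, a U ∂μ) ∧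
      ∀ ν : Measure (ι → G), IsProbabilityMeasure ν →
        (∀ a ∈ polyAlgebra (ι := ι) r, φ a = ∫ U, a U ∂ν) → ν = μ := by
  obtain ⟨μ, hμ, hμA⟩ := exists_probabilityMeasure_of_sqPositive_poly r h1 hpos
  refine ⟨μ, hμ, isPolySchwingerDysonState_of_isSDFunctional r hk hX hφ μ hμA,
    fun a ha => (hμA a ha).symm, fun ν hν hνA => ?_⟩
  exact eq_of_forall_integral_poly_eq r ν μ fun a ha => by rw [← hνA a ha, hμA a ha]

end SD

/-! ## `SU(N)` and `U(N)`: the torus and `ℤ^d` -/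

section Unitary

open Literature.MathematicalPhysics.QuantumFieldTheory (Edge GaugeConfig wilsonAction wilsonMeasure)
open Literature.MathematicalPhysics.QuantumLattice

variable {d L : ℕ}

/-- ★★★ **`SU(N)` on the torus `(ℤ/L)^d`, ANY real `β`: the untruncated bootstrap has exactly one
solution, the Wilson expectation.** A linear functional on the observables which is normalised,
square-positive on the polynomial observables and satisfies the loop equations (all links, all
`X ∈ 𝔰𝔲(N)`, all polynomial test functions) as linear identities equals `∫ · dμ_Wilson` on every
polynomial observable. No realisability hypothesis. [folklore] -/
theorem eq_wilson_of_bootstrap_suN [NeZero L] (N : ℕ) (β : ℝ)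
    {φ : C(GaugeConfig d L (Matrix.specialUnitaryGroup (Fin N) ℂ), ℝ) →ₗ[ℝ] ℝ} (h1 : φ 1 = 1)
    (hpos : ∀ a ∈ polyAlgebra (ι := Edge d L) (fundamentalLatticeRep N), 0 ≤ φ (a * a))
    (hφ : IsSDFunctional (fundamentalLatticeRep N) (suExp N)
      (fun _ => wilsonAction (fundamentalRep (Fin N))) β φ)
    {a : C(GaugeConfig d L (Matrix.specialUnitaryGroup (Fin N) ℂ), ℝ)}
    (ha : a ∈ polyAlgebra (ι := Edge d L) (fundamentalLatticeRep N)) :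
    φ a = ∫ U, a U ∂(wilsonMeasure (fundamentalRep (Fin N)) β) := by
  obtain ⟨μ, hμ, hsd, hφμ, -⟩ := exists_polySD_measure_of_bootstrap (fundamentalLatticeRep N)
    (suExp_add N) (X := fun X : SuGenerator N => (X : Matrix (Fin N) (Fin N) ℂ)) (rho_suExp N)
    h1 hpos hφ
  rw [hφμ a ha, (eq_wilsonMeasure_iff_polySD_suN N β μ).2 hsd]

/-- ★★★ **`U(N)` on the torus, ANY real `β`: the untruncated bootstrap (shifts `e^{tX}`,
`X ∈ 𝔲(N)`) has exactly one solution, the Wilson expectation.** [folklore] -/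
theorem eq_wilson_of_bootstrap_uN [NeZero L] (N : ℕ) (β : ℝ)
    {φ : C(GaugeConfig d L (Matrix.unitaryGroup (Fin N) ℂ), ℝ) →ₗ[ℝ] ℝ} (h1 : φ 1 = 1)
    (hpos : ∀ a ∈ polyAlgebra (ι := Edge d L) (unitaryFundamentalLatticeRep N), 0 ≤ φ (a * a))
    (hφ : IsSDFunctional (unitaryFundamentalLatticeRep N) (uExp N)
      (fun _ => wilsonAction (unitaryFundamentalRep (Fin N) ℂ)) β φ)
    {a : C(GaugeConfig d L (Matrix.unitaryGroup (Fin N) ℂ), ℝ)}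
    (ha : a ∈ polyAlgebra (ι := Edge d L) (unitaryFundamentalLatticeRep N)) :
    φ a = ∫ U, a U ∂(wilsonMeasure (unitaryFundamentalRep (Fin N) ℂ) β) := by
  obtain ⟨μ, hμ, hsd, hφμ, -⟩ := exists_polySD_measure_of_bootstrap (unitaryFundamentalLatticeRep N)
    (uExp_add N) (X := fun X : UGenerator N => (X : Matrix (Fin N) (Fin N) ℂ)) (rho_uExp N)
    h1 hpos hφ
  rw [hφμ a ha, (eq_wilsonMeasure_iff_polySD_uN N β μ).2 hsd]

/-- **Conversely the Wilson expectation solves the bootstrap** (`SU(N)`, torus; `μ` = Wilson's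
measure, a probability measure by `isProbabilityMeasure_wilsonMeasure`). [folklore] -/
theorem bootstrap_wilson_suN [NeZero L] (N : ℕ) (β : ℝ)
    (μ : Measure (GaugeConfig d L (Matrix.specialUnitaryGroup (Fin N) ℂ))) [IsProbabilityMeasure μ]
    (hμ : μ = wilsonMeasure (fundamentalRep (Fin N)) β) :
    expectationFunctional μ 1 = 1 ∧
      (∀ a : C(GaugeConfig d L (Matrix.specialUnitaryGroup (Fin N) ℂ), ℝ), 0 ≤ expectationFunctional μ (a * a)) ∧
      IsSDFunctional (fundamentalLatticeRep N) (suExp N) (fun _ => wilsonAction (fundamentalRep (Fin N)))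
        β (expectationFunctional μ) :=
  ⟨expectationFunctional_one _, expectationFunctional_sq_nonneg _,
    isSDFunctional_expectationFunctional (fundamentalLatticeRep N) (suExp_add N)
      (X := fun X : SuGenerator N => (X : Matrix (Fin N) (Fin N) ℂ)) (rho_suExp N)
      (fun _ => wilsonAction_mem_polyFunctions (fundamentalLatticeRep N)) _
      ((eq_wilsonMeasure_iff_polySD_suN N β μ).1 hμ)⟩

/-- ★★★ **`SU(N)` on `ℤ^d`, ANY real `β`: every solution of the untruncated bootstrap is the
expectation functional of a DLR state of the Wilson action** (on all polynomial, i.e. local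
polynomial, observables). [folklore] -/
theorem exists_dlr_of_bootstrap_suN (N : ℕ) (β : ℝ)
    {φ : C(LGConfig d (Matrix.specialUnitaryGroup (Fin N) ℂ), ℝ) →ₗ[ℝ] ℝ} (h1 : φ 1 = 1)
    (hpos : ∀ a ∈ polyAlgebra (ι := ZdEdge d) (fundamentalLatticeRep N), 0 ≤ φ (a * a))
    (hφ : IsSDFunctional (fundamentalLatticeRep N) (suExp N)
      (fun e => wilsonBoundaryAction (fundamentalRep (Fin N)) {e}) β φ) :
    ∃ μ ∈ ymGibbsMeasures (d := d) (fundamentalRep (Fin N)) β,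
      ∀ a ∈ polyAlgebra (ι := ZdEdge d) (fundamentalLatticeRep N), φ a = ∫ U, a U ∂μ := by
  obtain ⟨μ, hμ, hsd, hφμ, -⟩ := exists_polySD_measure_of_bootstrap (fundamentalLatticeRep N)
    (suExp_add N) (X := fun X : SuGenerator N => (X : Matrix (Fin N) (Fin N) ℂ)) (rho_suExp N)
    h1 hpos hφ
  exact ⟨μ, (isPolySchwingerDysonState_iff_mem_ymGibbsMeasures_suN N β μ).1 hsd, hφμ⟩

/-- ★★★ **`U(N)` on `ℤ^d`: every solution of the untruncated bootstrap is the expectation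
functional of a DLR state.** [folklore] -/
theorem exists_dlr_of_bootstrap_uN (N : ℕ) (β : ℝ)
    {φ : C(LGConfig d (Matrix.unitaryGroup (Fin N) ℂ), ℝ) →ₗ[ℝ] ℝ} (h1 : φ 1 = 1)
    (hpos : ∀ a ∈ polyAlgebra (ι := ZdEdge d) (unitaryFundamentalLatticeRep N), 0 ≤ φ (a * a))
    (hφ : IsSDFunctional (unitaryFundamentalLatticeRep N) (uExp N)
      (fun e => wilsonBoundaryAction (unitaryFundamentalRep (Fin N) ℂ) {e}) β φ) :
    ∃ μ ∈ ymGibbsMeasures (d := d) (unitaryFundamentalRep (Fin N) ℂ) β,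
      ∀ a ∈ polyAlgebra (ι := ZdEdge d) (unitaryFundamentalLatticeRep N), φ a = ∫ U, a U ∂μ := by
  obtain ⟨μ, hμ, hsd, hφμ, -⟩ := exists_polySD_measure_of_bootstrap (unitaryFundamentalLatticeRep N)
    (uExp_add N) (X := fun X : UGenerator N => (X : Matrix (Fin N) (Fin N) ℂ)) (rho_uExp N)
    h1 hpos hφ
  exact ⟨μ, (isPolySchwingerDysonState_iff_mem_ymGibbsMeasures_uN N β μ).1 hsd, hφμ⟩

/-- **Conversely every DLR state solves the bootstrap** (`SU(N)`, `ℤ^d`). [folklore] -/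
theorem bootstrap_of_dlr_suN (N : ℕ) (β : ℝ) {μ : Measure (LGConfig d (Matrix.specialUnitaryGroup (Fin N) ℂ))}
    [IsProbabilityMeasure μ] (hμ : μ ∈ ymGibbsMeasures (d := d) (fundamentalRep (Fin N)) β) :
    expectationFunctional μ 1 = 1 ∧
      (∀ a : C(LGConfig d (Matrix.specialUnitaryGroup (Fin N) ℂ), ℝ), 0 ≤ expectationFunctional μ (a * a)) ∧
      IsSDFunctional (fundamentalLatticeRep N) (suExp N)
        (fun e => wilsonBoundaryAction (fundamentalRep (Fin N)) {e}) β (expectationFunctional μ) :=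
  ⟨expectationFunctional_one _, expectationFunctional_sq_nonneg _,
    isSDFunctional_expectationFunctional (fundamentalLatticeRep N) (suExp_add N)
      (X := fun X : SuGenerator N => (X : Matrix (Fin N) (Fin N) ℂ)) (rho_suExp N)
      (fun e => wilsonBoundaryAction_mem_polyFunctions (fundamentalLatticeRep N) {e}) _
      ((isPolySchwingerDysonState_iff_mem_ymGibbsMeasures_suN N β μ).2 hμ)⟩

end Unitary

end Summit.QuantumFields.GaugeBoot

end
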